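import Literature.Combinatorics.SimpleGraph.HamiltonianRailGadget
import Literature.Combinatorics.SimpleGraph.HamiltonianGadgetTransport
import HarnessLib

/-!
# Gadget substitution for Hamiltonian-path counts, IX: placing a rail gadget on numbered vertices

A rail-gadget template (`RailGadget`, on its own vertex type `RailV k K m`) is placed into a graph on
`ℕ` by a **placement** `P`: its inner vertices are numbered consecutively from `P.base`
(`node (r, i) ↦ base + r·K + i`, `mid ρ ↦ base + k·K + ρ`) and its ports are sent to prescribed
numbered vertices `P.ends r = (u_r, v_r)` below `base` (the two ends of the slot edge of rail `r`).
This is an embedding `P.emb : RailV k K m ↪ ℕ`; the placed gadget is `P.GX = Γ.graph.map emb` on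
`P.VX = Γ.VX.map emb` with slots `P.S = {(u_r, v_r)}`. This file proves the hypotheses of
`Substitution` / `GadgetFamily.Valid` for a placed gadget (`gadget_adj`, `port_unique`,
`exclusive`) and computes its census from the template's (`coverCount_image`), using the transport
lemmas of `HamiltonianGadgetTransport.lean`.

## References

* M. R. Garey, D. S. Johnson, *Computers and Intractability*, Freeman 1979, §3.2.2.
-/

namespace Literature.Combinatorics.SimpleGraph

open RailV

/-! ### Template facts -/

namespace RailGadget

variable {k K m : ℕ} (Γ : RailGadget k K m)

/-- Every edge of a rail gadget has an inner end point. [folklore] -/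
theorem isInner_or_of_adj {a b : RailV k K m} (h : Γ.graph.Adj a b) : isInner a = true ∨ isInner b = true := by
  cases a with
  | node x => exact Or.inl rfl
  | mid ρ => exact Or.inl rfl
  | port r t =>
    cases t
    · obtain ⟨x, rfl, -⟩ := (Γ.adj_port_false_iff).1 h; exact Or.inr rfl
    · obtain ⟨x, rfl, -⟩ := (Γ.adj_port_true_iff).1 h; exact Or.inr rfl

/-- A port of a rail gadget has only one neighbour. [folklore] -/
theorem eq_of_adj_port {r : Fin k} {t : Bool} {x y : RailV k K m} (hx : Γ.graph.Adj (port r t) x)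
    (hy : Γ.graph.Adj (port r t) y) : x = y := by
  cases t
  · obtain ⟨x', rfl, h1, h2⟩ := (Γ.adj_port_false_iff).1 hx
    obtain ⟨y', rfl, h1', h2'⟩ := (Γ.adj_port_false_iff).1 hy
    congr 1
    exact Prod.ext (h1.trans h1'.symm) (Fin.ext (by omega))
  · obtain ⟨x', rfl, h1, h2⟩ := (Γ.adj_port_true_iff).1 hx
    obtain ⟨y', rfl, h1', h2'⟩ := (Γ.adj_port_true_iff).1 hy
    congr 1
    exact Prod.ext (h1.trans h1'.symm) (Fin.ext (by omega))

/-- A vertex of a rail gadget is inner or a port of a slot. [folklore] -/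
theorem isInner_or_mem_ports (v : RailV k K m) : isInner v = true ∨ v ∈ ports Γ.slots := by
  cases v with
  | node x => exact Or.inl rfl
  | mid ρ => exact Or.inl rfl
  | port r t => exact Or.inr (Γ.mem_ports_slots_iff.2 ⟨r, t, rfl⟩)

end RailGadget

/-! ### Placements -/

/-- **A placement of a rail gadget on numbered vertices**: the template, the first number of its
block of inner vertices, and the numbered ends `(u_r, v_r)` of the slot edge of each rail — below
the block, the two ends of a slot distinct, and distinct slots with pairwise distinct ends.
[cite: GareyJohnson1979, §3.2.2 (local replacement by a copy of the gadget)] -/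
structure RailPlacement where
  /-- number of rails -/
  k : ℕ
  /-- nodes per rail -/
  K : ℕ
  /-- number of rungs -/
  m : ℕ
  /-- the template -/
  Γ : RailGadget k K m
  /-- first numbered inner vertex -/
  base : ℕ
  /-- the numbered ends of the slot edges -/
  ends : Fin k → ℕ × ℕ
  ends_lt : ∀ r, (ends r).1 < base ∧ (ends r).2 < base
  ends_ne : ∀ r, (ends r).1 ≠ (ends r).2
  ends_distinct : ∀ r r', r ≠ r' →
    (ends r).1 ≠ (ends r').1 ∧ (ends r).1 ≠ (ends r').2 ∧ (ends r).2 ≠ (ends r').1 ∧ (ends r).2 ≠ (ends r').2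

namespace RailPlacement

variable (P : RailPlacement)

/-- The numbering of the template's vertices. [folklore] -/
def embFun : RailV P.k P.K P.m → ℕ
  | node x => P.base + (x.1.val * P.K + x.2.val)
  | mid ρ => P.base + (P.k * P.K + ρ.val)
  | port r true => (P.ends r).1
  | port r false => (P.ends r).2

/-- The code of a node within the block is below `k·K`. [folklore] -/
theorem node_code_lt (x : Fin P.k × Fin P.K) : x.1.val * P.K + x.2.val < P.k * P.K := by
  have h1 := x.1.isLt
  have h2 := x.2.isLt
  calc x.1.val * P.K + x.2.val < x.1.val * P.K + P.K := Nat.add_lt_add_left h2 _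
    _ = (x.1.val + 1) * P.K := (Nat.succ_mul _ _).symm
    _ ≤ P.k * P.K := Nat.mul_le_mul_right _ h1

/-- Inner vertices are numbered from `base` on, ports below `base`. [folklore] -/
theorem base_le_embFun_iff (v : RailV P.k P.K P.m) : P.base ≤ P.embFun v ↔ isInner v = true := by
  cases v with
  | node x => simp [embFun, isInner]
  | mid ρ => simp [embFun, isInner]
  | port r t =>
    have := P.ends_lt r
    cases t <;> simp [embFun, isInner] <;> omega

/-- Inner vertices are numbered below `base + k·K + m`. [folklore] -/
theorem embFun_lt_of_isInner {v : RailV P.k P.K P.m} (hv : isInner v = true) : P.embFun v < P.base + (P.k * P.K + P.m) := by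
  cases v with
  | node x => have := P.node_code_lt x; simp only [embFun]; omega
  | mid ρ => have := ρ.isLt; simp only [embFun]; omega
  | port r t => simp [isInner] at hv

/-- The numbering is injective. [folklore] -/
theorem embFun_injective : Function.Injective P.embFun := by
  intro v w h
  have hvw : isInner v = isInner w := by
    have h1 := P.base_le_embFun_iff v
    have h2 := P.base_le_embFun_iff w
    rw [h] at h1
    cases hv : isInner v <;> cases hw : isInner w
    · rfl
    · rw [hw] at h2; rw [hv] at h1; exact absurd (h2.2 rfl) (by rw [h1]; simp)
    · rw [hw] at h2; rw [hv] at h1; exact absurd (h1.2 rfl) (by rw [h2]; simp)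
    · rfl
  cases v with
  | node x =>
    cases w with
    | node y =>
      simp only [embFun] at h
      have h' : x.1.val * P.K + x.2.val = y.1.val * P.K + y.2.val := by omega
      have hx2 := x.2.isLt
      have hy2 := y.2.isLt
      have hK : 0 < P.K := P.Γ.pos
      have e1 : (x.1.val * P.K + x.2.val) / P.K = x.1.val := by
        rw [Nat.mul_comm, Nat.mul_add_div hK, Nat.div_eq_of_lt hx2, Nat.add_zero]
      have e2 : (y.1.val * P.K + y.2.val) / P.K = y.1.val := by
        rw [Nat.mul_comm, Nat.mul_add_div hK, Nat.div_eq_of_lt hy2, Nat.add_zero]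
      have h1 : x.1.val = y.1.val := by rw [← e1, ← e2, h']
      have h2 : x.2.val = y.2.val := by rw [h1] at h'; omega
      exact congrArg node (Prod.ext (Fin.ext h1) (Fin.ext h2))
    | mid ρ =>
      simp only [embFun] at h
      have := P.node_code_lt x
      omega
    | port r t => simp [isInner] at hvw
  | mid ρ =>
    cases w with
    | node y =>
      simp only [embFun] at h
      have := P.node_code_lt y
      omega
    | mid ρ' =>
      simp only [embFun] at h
      exact congrArg mid (Fin.ext (by omega))
    | port r t => simp [isInner] at hvw
  | port r t =>
    cases w with
    | node y => simp [isInner] at hvw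
    | mid ρ' => simp [isInner] at hvw
    | port r' t' =>
      by_cases hrr : r = r'
      · subst hrr
        cases t <;> cases t' <;> simp only [embFun] at h
        · rfl
        · exact absurd h.symm (P.ends_ne r)
        · exact absurd h (P.ends_ne r)
        · rfl
      · obtain ⟨d1, d2, d3, d4⟩ := P.ends_distinct r r' hrr
        cases t <;> cases t' <;> simp only [embFun] at h
        · exact absurd h d4
        · exact absurd h d3
        · exact absurd h d2
        · exact absurd h d1

/-- **The embedding of the template.** [folklore] -/
def emb : RailV P.k P.K P.m ↪ ℕ :=
  ⟨P.embFun, P.embFun_injective⟩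

/-- The embedding is the numbering. [folklore] -/
@[simp] theorem emb_apply (v : RailV P.k P.K P.m) : P.emb v = P.embFun v := rfl

/-- **The placed gadget graph.** [folklore] -/
def GX : _root_.SimpleGraph ℕ :=
  P.Γ.graph.map P.emb

/-- **The placed gadget vertices.** [folklore] -/
def VX : Finset ℕ :=
  P.Γ.VX.map P.emb

/-- **The placed slots**: `(u_r, v_r)`. [folklore] -/
def S : Finset (ℕ × ℕ) :=
  P.Γ.slots.map (P.emb.prodMap P.emb)

/-- The placed slots are the prescribed slot ends. [folklore] -/
theorem mem_S_iff {e : ℕ × ℕ} : e ∈ P.S ↔ ∃ r, e = P.ends r := by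
  simp only [S, Finset.mem_map, Function.Embedding.prodMap, Function.Embedding.coeFn_mk, Prod.exists, Prod.map_apply,
    emb_apply]
  constructor
  · rintro ⟨a, b, hab, rfl⟩
    obtain ⟨r, hr⟩ := P.Γ.mem_slots_iff.1 hab
    simp only [RailGadget.slot, Prod.mk.injEq] at hr
    obtain ⟨rfl, rfl⟩ := hr
    exact ⟨r, by simp [embFun]⟩
  · rintro ⟨r, rfl⟩
    exact ⟨port r true, port r false, P.Γ.mem_slots_iff.2 ⟨r, rfl⟩, by simp [embFun]⟩

/-- Placed gadget vertices lie in the block. [folklore] -/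
theorem mem_VX_bounds {v : ℕ} (hv : v ∈ P.VX) : P.base ≤ v ∧ v < P.base + (P.k * P.K + P.m) := by
  obtain ⟨w, hw, rfl⟩ := Finset.mem_map.1 hv
  have hin : isInner w = true := P.Γ.mem_VX_iff.1 hw
  exact ⟨(P.base_le_embFun_iff w).2 hin, P.embFun_lt_of_isInner hin⟩

/-- Images of inner vertices are placed gadget vertices. [folklore] -/
theorem emb_mem_VX {w : RailV P.k P.K P.m} (hw : isInner w = true) : P.emb w ∈ P.VX :=
  Finset.mem_map_of_mem _ (P.Γ.mem_VX_iff.2 hw)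

/-- Images of ports are ports of the placed slots. [folklore] -/
theorem emb_mem_ports {w : RailV P.k P.K P.m} (hw : w ∈ ports P.Γ.slots) : P.emb w ∈ ports P.S := by
  rw [S, ports_map]
  exact Finset.mem_map_of_mem _ hw

/-- **Placed gadget edges attach to ports only.** [folklore] -/
theorem gadget_adj (a b : ℕ) (h : P.GX.Adj a b) :
    (a ∈ P.VX ∨ b ∈ P.VX) ∧ (a ∈ P.VX ∨ a ∈ ports P.S) ∧ (b ∈ P.VX ∨ b ∈ ports P.S) := by
  obtain ⟨⟨a', rfl⟩, ⟨b', rfl⟩⟩ := exists_eq_of_map_adj P.emb h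
  have h' : P.Γ.graph.Adj a' b' := (map_adj_iff P.emb).1 h
  refine ⟨?_, ?_, ?_⟩
  · rcases P.Γ.isInner_or_of_adj h' with ha | hb
    · exact Or.inl (P.emb_mem_VX ha)
    · exact Or.inr (P.emb_mem_VX hb)
  · rcases P.Γ.isInner_or_mem_ports a' with ha | ha
    · exact Or.inl (P.emb_mem_VX ha)
    · exact Or.inr (P.emb_mem_ports ha)
  · rcases P.Γ.isInner_or_mem_ports b' with hb | hb
    · exact Or.inl (P.emb_mem_VX hb)
    · exact Or.inr (P.emb_mem_ports hb)

/-- **One port edge at each placed port.** [folklore] -/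
theorem port_unique (p : ℕ) (hp : p ∈ ports P.S) (x y : ℕ) (hx : P.GX.Adj p x) (hy : P.GX.Adj p y) : x = y := by
  obtain ⟨p', hp', rfl⟩ := exists_eq_of_mem_ports_map P.emb (by rwa [S] at hp)
  obtain ⟨r, t, rfl⟩ := P.Γ.mem_ports_slots_iff.1 hp'
  obtain ⟨-, ⟨x', rfl⟩⟩ := exists_eq_of_map_adj P.emb hx
  obtain ⟨-, ⟨y', rfl⟩⟩ := exists_eq_of_map_adj P.emb hy
  rw [P.Γ.eq_of_adj_port ((map_adj_iff P.emb).1 hx) ((map_adj_iff P.emb).1 hy)]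

/-- **A placed exclusive gadget is exclusive.** [folklore] -/
theorem exclusive (hE : Exclusive P.Γ.graph P.Γ.VX P.Γ.slots) : Exclusive P.GX P.VX P.S :=
  hE.map P.emb

/-- **The census of a placed gadget is the census of the template.** [folklore] -/
theorem coverCount_image (U₀ : Finset (Fin P.k)) :
    coverCount P.GX P.VX (U₀.image P.ends) = coverCount P.Γ.graph P.Γ.VX (U₀.image P.Γ.slot) := by
  have : U₀.image P.ends = (U₀.image P.Γ.slot).map (P.emb.prodMap P.emb) := by
    ext e
    simp only [Finset.mem_image, Finset.mem_map, Function.Embedding.prodMap, Function.Embedding.coeFn_mk,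
      Prod.map_apply, emb_apply, exists_exists_and_eq_and, RailGadget.slot]
    constructor
    · rintro ⟨r, hr, rfl⟩
      exact ⟨r, hr, by simp [embFun]⟩
    · rintro ⟨r, hr, rfl⟩
      exact ⟨r, hr, by simp [embFun]⟩
  rw [this, GX, VX, coverCount_map]

/-- Every subset of the placed slots is the image of a set of rails. [folklore] -/
theorem exists_eq_image_ends {U : Finset (ℕ × ℕ)} (hU : U ⊆ P.S) : ∃ U₀ : Finset (Fin P.k), U = U₀.image P.ends := by
  classical
  have : U ⊆ Finset.univ.image P.ends := fun e he => by
    obtain ⟨r, rfl⟩ := P.mem_S_iff.1 (hU he)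
    exact Finset.mem_image_of_mem _ (Finset.mem_univ r)
  obtain ⟨U₀, -, h⟩ := Finset.subset_image_iff.1 this
  exact ⟨U₀, h.symm⟩

end RailPlacement

end Literature.Combinatorics.SimpleGraph
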